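import Summits.QuantumFields.BalabanUV.Beta.GAN24.HalfReadout

/-!
# `BalabanUV.Beta.GAN24.ExchangeBondLegs` — row G-an2-4 ∕ (CONV-C), W-slot, road «W3» (SKELETON-W3 §7.2 ∕ §8.3 (F2)), «W3-S3C*» PART 6
# module (C1): THE LOCATED MECHANISM OF THE EXCHANGE CHANNEL — the middle kernel `(dM_{(κ,u)} ∘ K) ∘ dM_{(κ′,u′)}` of an exchange tree has,
# summed over the free table bond `u′` AND its two field legs, total ZERO:
# `HasSum (u′ ↦ Σ'_{(v,w)} ((dM K N S M κ u ∘ K) ∘ dM K N S M κ′ u′)(v, w)_{(inl a, inl b)}) 0`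

NOT IN PRINT; OUR BOOKKEEPING (idle-seat kernel lemma, unit `b2b-balaban-gan24-formalise-leaf-06`, gen 9).  HONEST FRAMING (cell contract,
verbatim): «discharging `BetaPertH` makes Bałaban's UV stability UNCONDITIONAL — a real constructive-QFT result; it is NOT the continuum limit and
NOT the Clay problem.»  HONEST DEPENDENCY (verbatim): «continuum YM on T⁴ ⇐ BetaPertH ∧ nine spine estimates (0/9 proved); BetaPertH ⇐ (D1) ∧ (D4)
∧ CAP+tail; G-an2-4 gates asym, D1 and NE2/3/4.»

THE MECHANISM (SKELETON-W3 §7.2 «(S3c) twice turns the ff-blocks off, the surviving multiplier vectors q, q′ are constant by (Q-lin) and die»),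
generic `d`, `N ≥ 1`; `K` given by decay, site-free coarse-leg charges vanishing on multiplier legs, multiplier SECOND legs vanishing off the coarse
lattice; `S` a local stencil family with (S3c) (legs pair ∧ table + second leg) as HYPOTHESES and block covariance; `M` a block-covariant vertex
family: `hasSum_collapse_right_pt` (pointwise-charge q-vector collapse); `summable_bond_leg2_dM` ∕ `hasSum_bond_leg2_dM` (the `(bond, second leg)`
pair family of an2's `dM` at a fixed first leg, value `Σ'_w Σ_κ ρR (inl κ) · Σ'_t S κ t q w e g`); **`hasSum_bond_legs_exchange`**: ONE absolutely
convergent quadruple family `((v,q),(u′,w)) ↦ Σ_e (dM_b ∘ K)(v,q)_{(inl a, e)} · dM_{(κ′,u′)}(q,w)_{(e, inl b)}` summed both ways (`hasSum_fibre_swap`):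
its `(u′,w)`-fibres leave the table-summed stencil on its second leg — field part dies ((S3c) table + second leg), multiplier part = the border's
block-PERIODIC q-vector, collapsed onto the coarse column sum of `dM_b ∘ K` = a RIGHT HALF READ-OUT (module (A′)) = field charges × `dM_b` on two
constant kernel legs = 0 (module (A) `hasSum_dM_legs_ff`); its `(v,q)`-fibres, regrouped per bond by two index equivalences, are the double-leg sums
of the middle kernel.  Consumed by module (C2) `ExchangeZeroMode`.  Asserts NO shape or value of Bałaban's tables, pins no colour constant;
discharges NOTHING of ROW W3-F2a ∕ F2b, «T2Shape» ∕ «T2SupRate», (hW, hWall); NOT «W-slot closed», NEVER «G-an2-4 closed»; NOT BetaPertH, NOT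
continuum, NOT Clay.  0 `def`, 0 cite, 0 sorry.
-/

noncomputable section

open Finset
open scoped BigOperators
open Literature.MathematicalPhysics.QuantumFieldTheory
open Literature.MathematicalPhysics.QuantumFieldTheory.Balaban1983to89
open Literature.MathematicalPhysics.QuantumFieldTheory.Balaban1983to89.Beta
open Literature.Probability.LatticeModels (Torus.proj)
open B12Sec2to5 (l1 l1_nonneg)
open ExpKernelCalculus (Site MKer BiLoc Decays VertexFamily comp shiftK Zl Zl_nonneg summable_exp_shift' tsum_exp_shift')
open OneStepResolventKernel (Fib LocStencil decays_mono)
open SecondOrderResponse (colM dM vertexFamily_dM)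
open BalabanStepJetsSucc (biLoc_comp_right)
open Summit.QuantumFields.BalabanUV.Beta.GAN24.KernelLegCharges (summable_prod_of_biLoc)
open Summit.QuantumFields.BalabanUV.Beta.GAN24.ResolventLegCharges (tsum_exp_coarse_le' summable_exp_coarse')
open Summit.QuantumFields.BalabanUV.Beta.GAN24.DMBondCharges (hasSum_fibre_swap mem_range_zsmul_iff hasSum_dM_bond summable_tableSum_leg2
  hasSum_tableSum_leg2 tableSum_periodic hasSum_dM_legs_ff)
open Summit.QuantumFields.BalabanUV.Beta.GAN24.MultiplierVertexBondSum (zsmul_injective)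
open Summit.QuantumFields.BalabanUV.Beta.GAN24.HalfReadout (hasSum_halfReadout_right)

namespace Summit.QuantumFields.BalabanUV.Beta.GAN24.ExchangeBondLegs

variable {d : ℕ} {N : ℕ} [NeZero N]

/-- [folklore] **THE q-VECTOR COLLAPSE, POINTWISE CHARGE** (module (A)'s `hasSum_collapse_right` with the coarse column sum `r` of THIS row
only): if `G p q c (inr β)` vanishes for `q` off the coarse lattice and `HasSum (q′ ↦ G p (N•q′) c (inr β)) r`, then for every `N`-periodic `Ψ`,
`HasSum (q ↦ G p q c (inr β) · Ψ q) (r · Ψ 0)`. -/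
theorem hasSum_collapse_right_pt {G : MKer (d + 1) (Fib d)} {β : Fin (d + 1)} {p : Site (d + 1)} {c : Fib d} {r : ℝ}
    (hcolp : HasSum (fun q' : Site (d + 1) => G p ((N : ℤ) • q') c (Sum.inr β)) r)
    (hoff : ∀ q : Site (d + 1), Torus.proj N q ≠ 0 → G p q c (Sum.inr β) = 0)
    {Ψ : Site (d + 1) → ℝ} (hΨ : ∀ q s : Site (d + 1), Ψ (q + (N : ℤ) • s) = Ψ q) :
    HasSum (fun q : Site (d + 1) => G p q c (Sum.inr β) * Ψ q) (r * Ψ 0) := by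
  have hinj : Function.Injective (fun q' : Site (d + 1) => (N : ℤ) • q') := zsmul_injective
  have hzero : ∀ q ∉ Set.range (fun q' : Site (d + 1) => (N : ℤ) • q'), G p q c (Sum.inr β) * Ψ q = 0 :=
    fun q hq => by rw [hoff q (mt (mem_range_zsmul_iff q).2 hq), zero_mul]
  refine (hinj.hasSum_iff hzero).1 ?_
  have e : ∀ q' : Site (d + 1), Ψ ((N : ℤ) • q') = Ψ 0 := fun q' => by simpa only [zero_add] using hΨ 0 q'
  show HasSum (fun q' : Site (d + 1) => G p ((N : ℤ) • q') c (Sum.inr β) * Ψ ((N : ℤ) • q')) _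
  simp_rw [e]
  exact hcolp.mul_right (Ψ 0)

variable {K : MKer (d + 1) (Fib d)} {C m : ℝ} {ρL ρR : Fin (d + 1) → Fib d → ℝ}
  {S : Fin (d + 1) → Site (d + 1) → MKer (d + 1) (Fib d)} {Cs : ℝ}
  {M : Fin (d + 1) → Site (d + 1) → MKer (d + 1) (Fib d)} {CM : ℝ}

/-- [folklore] The `(bond, second leg)` family `(u′, w) ↦ dM K N S M κ′ u′ q w e g` at a fixed first leg `q` converges absolutely (uniform
bi-localisation of the bond family at its own bond, `vertexFamily_dM`; one uniform coarse exponential sum). -/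
theorem summable_bond_leg2_dM (hK : Decays K C m) (hm : 0 < m) (hS : LocStencil S Cs m) (hM : VertexFamily M N CM m)
    (κ' : Fin (d + 1)) (q : Site (d + 1)) (e g : Fib d) :
    Summable fun uw : Site (d + 1) × Site (d + 1) => dM K N S M κ' uw.1 q uw.2 e g := by
  have hN : 1 ≤ N := Nat.one_le_iff_ne_zero.2 (NeZero.ne N)
  have hC : 0 ≤ C := hK.nonneg (Sum.inl 0)
  have hm2 : 0 < m / 2 := half_pos hm
  have hV := vertexFamily_dM (N := N) hK hC hS hM hm le_rfl
  set CV : ℝ := (d + 1 : ℕ) * (C * Cs * Zl (d + 1) (m / 2)) + (d + 1 : ℕ) * (C * CM * Zl (d + 1) (m / 2)) with hCV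
  have hCV0 : 0 ≤ CV := (hV 0 0).nonneg (Sum.inl 0)
  have hM0 : 0 ≤ fun uw : Site (d + 1) × Site (d + 1) =>
      (CV * Real.exp (-(m / 2) * l1 (q - (N : ℤ) • uw.1))) * Real.exp (-(m / 2) * l1 (uw.2 - (N : ℤ) • uw.1)) :=
    fun uw => by positivity
  have hMfib : ∀ u' : Site (d + 1), Summable fun w : Site (d + 1) =>
      (CV * Real.exp (-(m / 2) * l1 (q - (N : ℤ) • u'))) * Real.exp (-(m / 2) * l1 (w - (N : ℤ) • u')) :=
    fun u' => (summable_exp_shift' hm2 _).mul_left _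
  have hMsum : Summable fun u' : Site (d + 1) => ∑' w : Site (d + 1),
      (CV * Real.exp (-(m / 2) * l1 (q - (N : ℤ) • u'))) * Real.exp (-(m / 2) * l1 (w - (N : ℤ) • u')) := by
    have e1 : (fun u' : Site (d + 1) => ∑' w : Site (d + 1),
        (CV * Real.exp (-(m / 2) * l1 (q - (N : ℤ) • u'))) * Real.exp (-(m / 2) * l1 (w - (N : ℤ) • u')))
        = fun u' => (CV * Zl (d + 1) (m / 2)) * Real.exp (-(m / 2) * l1 (q - (N : ℤ) • u')) := by
      funext u'
      rw [tsum_mul_left, tsum_exp_shift']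
      ring
    rw [e1]
    exact (summable_exp_coarse' (d := d) hN hm2 q).mul_left _
  have hmaj := (summable_prod_of_nonneg hM0).2 ⟨hMfib, hMsum⟩
  refine Summable.of_norm_bounded hmaj (fun uw => ?_)
  rw [Real.norm_eq_abs]
  have h := hV κ' uw.1 q uw.2 e g
  rw [mul_add, Real.exp_add] at h
  calc |dM K N S M κ' uw.1 q uw.2 e g| ≤ CV * (Real.exp (-(m / 2) * l1 (q - (N : ℤ) • uw.1)) * Real.exp (-(m / 2) * l1 (uw.2 - (N : ℤ) • uw.1))) := h
    _ = _ := by ring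

/-- [folklore] **THE `(bond, second leg)` DOUBLE SUM OF `dM` AT A FIXED FIRST LEG**: with site-free column charges (bond sum through the
column charge, module (A) `hasSum_dM_bond`, fibrewise in `w`), `HasSum ((u′,w) ↦ dM K N S M κ′ u′ q w e g) (Σ'_w Σ_κ ρR κ′ (inl κ) · Σ'_t S κ t q w e g)`. -/
theorem hasSum_bond_leg2_dM (hK : Decays K C m) (hm : 0 < m)
    (hcol : ∀ β g w, HasSum (fun z' : Site (d + 1) => K w ((N : ℤ) • z') g (Sum.inr β)) (ρR β g))
    (hK0 : ∀ (μ ρ : Fin (d + 1)) (w : Site (d + 1)), HasSum (fun y : Site (d + 1) => colM K N μ y ρ w) 0)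
    (hS : LocStencil S Cs m) (hM : VertexFamily M N CM m) (κ' : Fin (d + 1)) (q : Site (d + 1)) (e g : Fib d) :
    HasSum (fun uw : Site (d + 1) × Site (d + 1) => dM K N S M κ' uw.1 q uw.2 e g)
      (∑' w : Site (d + 1), ∑ κ : Fin (d + 1), ρR κ' (Sum.inl κ) * ∑' t : Site (d + 1), S κ t q w e g) := by
  have hs := summable_bond_leg2_dM hK hm hS hM κ' q e g
  have hfib : ∀ w : Site (d + 1), HasSum (fun u' : Site (d + 1) => dM K N S M κ' u' q w e g)
      (∑ κ : Fin (d + 1), ρR κ' (Sum.inl κ) * ∑' t : Site (d + 1), S κ t q w e g) :=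
    fun w => hasSum_dM_bond hK hm κ' (hcol κ') hK0 hS hM q w e g
  have h := hs.prod_symm.hasSum.prod_fiberwise hfib
  have e1 : ∑' wu : Site (d + 1) × Site (d + 1), dM K N S M κ' wu.swap.1 q wu.swap.2 e g
      = ∑' uw : Site (d + 1) × Site (d + 1), dM K N S M κ' uw.1 q uw.2 e g := by
    have h1 := (Equiv.prodComm (Site (d + 1)) (Site (d + 1))).tsum_eq
      (fun uw : Site (d + 1) × Site (d + 1) => dM K N S M κ' uw.1 q uw.2 e g)
    simpa only [Equiv.prodComm_apply] using h1
  rw [h.tsum_eq, e1]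
  exact hs.hasSum

/-- [folklore] **THE LOCATED MECHANISM OF THE EXCHANGE CHANNEL.**  For `K` (decay `m`; site-free coarse-leg charges `ρL`, `ρR` vanishing on the
multiplier legs; multiplier SECOND legs vanishing off the coarse lattice), a local stencil family `S` with the (S3c) sum rules «legs pair» and
«table + second leg» and block covariance, and a block-covariant vertex family `M`: for every fixed bond `(κ, u)`, every table direction `κ′` and
fibre pair `(a, b)`, `HasSum (u′ ↦ Σ'_{(v,w)} ((dM K N S M κ u ∘ K) ∘ dM K N S M κ′ u′)(v, w)_{(inl a, inl b)}) 0`. -/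
theorem hasSum_bond_legs_exchange (hK : Decays K C m) (hm : 0 < m)
    (hrow : ∀ α f y, HasSum (fun x' : Site (d + 1) => K ((N : ℤ) • x') y (Sum.inr α) f) (ρL α f))
    (hcol : ∀ β g w, HasSum (fun z' : Site (d + 1) => K w ((N : ℤ) • z') g (Sum.inr β)) (ρR β g))
    (hL0 : ∀ α μ, ρL α (Sum.inr μ) = 0) (hR0 : ∀ β μ, ρR β (Sum.inr μ) = 0)
    (hoffR : ∀ (x z : Site (d + 1)) (a : Fib d) (ρ : Fin (d + 1)), Torus.proj N z ≠ 0 → K x z a (Sum.inr ρ) = 0)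
    (hS : LocStencil S Cs m)
    (hS0 : ∀ (κ : Fin (d + 1)) (t : Site (d + 1)) (a b : Fin (d + 1)),
      HasSum (fun vp : Site (d + 1) × Site (d + 1) => S κ t vp.1 vp.2 (Sum.inl a) (Sum.inl b)) 0)
    (hS2 : ∀ (κ : Fin (d + 1)) (p : Site (d + 1)) (a b : Fin (d + 1)),
      HasSum (fun tq : Site (d + 1) × Site (d + 1) => S κ tq.1 p tq.2 (Sum.inl a) (Sum.inl b)) 0)
    (hSt : ∀ (κ : Fin (d + 1)) (u s : Site (d + 1)), S κ (u + (N : ℤ) • s) = shiftK (-((N : ℤ) • s)) (S κ u))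
    (hM : VertexFamily M N CM m) (hMt : ∀ (ρ : Fin (d + 1)) (w t : Site (d + 1)), M ρ (w + t) = shiftK (-((N : ℤ) • t)) (M ρ w))
    (κ : Fin (d + 1)) (u : Site (d + 1)) (κ' a b : Fin (d + 1)) :
    HasSum (fun u' : Site (d + 1) => ∑' vw : Site (d + 1) × Site (d + 1),
      comp (comp (dM K N S M κ u) K) (dM K N S M κ' u') vw.1 vw.2 (Sum.inl a) (Sum.inl b)) 0 := by
  classical
  have hN : 1 ≤ N := Nat.one_le_iff_ne_zero.2 (NeZero.ne N)
  have hC : 0 ≤ C := hK.nonneg (Sum.inl 0)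
  have hm2 : 0 < m / 2 := half_pos hm
  have hm4 : 0 < m / 4 := by positivity
  have hK0 : ∀ (μ ρ : Fin (d + 1)) (w : Site (d + 1)), HasSum (fun y : Site (d + 1) => colM K N μ y ρ w) 0 :=
    fun μ ρ w => by simpa only [hR0, colM] using hcol μ (Sum.inr ρ) ((N : ℤ) • w)
  have hK0' : ∀ (μ ρ : Fin (d + 1)) (y : Site (d + 1)), HasSum (fun w : Site (d + 1) => colM K N μ y ρ w) 0 :=
    fun μ ρ y => by simpa only [hL0, colM] using hrow ρ (Sum.inr μ) ((N : ℤ) • y)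
  -- the bond family and the fixed composite `Gb := dM_b ∘ K`
  have hV := vertexFamily_dM (N := N) hK hC hS hM hm le_rfl
  set CV : ℝ := (d + 1 : ℕ) * (C * Cs * Zl (d + 1) (m / 2)) + (d + 1 : ℕ) * (C * CM * Zl (d + 1) (m / 2)) with hCV
  have hCV0 : 0 ≤ CV := (hV 0 0).nonneg (Sum.inl 0)
  have hK2 : Decays K C (m / 2) := decays_mono hK hC le_rfl (by linarith)
  have hGb : BiLoc (comp (dM K N S M κ u) K) ((N : ℤ) • u) ((N : ℤ) • u)
      ((Fintype.card (Fib d) : ℝ) * (CV * C) * Zl (d + 1) (m / 2 - m / 4)) (m / 4) := biLoc_comp_right (hV κ u) hK2 hm4.le (by linarith)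
  set CG : ℝ := (Fintype.card (Fib d) : ℝ) * (CV * C) * Zl (d + 1) (m / 2 - m / 4) with hCG
  have hCG0 : 0 ≤ CG := hGb.nonneg (Sum.inl 0)
  set A : ℝ := (Fintype.card (Fib d) : ℝ) * (CG * CV) with hA
  have hA0 : 0 ≤ A := by positivity
  set U : ℝ := Real.exp ((m / 2) * ((N : ℝ) * (d + 1))) * Zl (d + 1) (m / 2) with hU
  have hU0 : 0 ≤ U := mul_nonneg (Real.exp_pos _).le (Zl_nonneg hm2)
  -- the quadruple family `((v,q),(u′,w))` and its majorant
  have hGle : ∀ s : (Site (d + 1) × Site (d + 1)) × (Site (d + 1) × Site (d + 1)),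
      |∑ e, comp (dM K N S M κ u) K s.1.1 s.1.2 (Sum.inl a) e * dM K N S M κ' s.2.1 s.1.2 s.2.2 e (Sum.inl b)|
        ≤ (A * Real.exp (-(m / 4) * l1 (s.1.1 - (N : ℤ) • u)) * Real.exp (-(m / 4) * l1 (s.1.2 - (N : ℤ) • u))) *
          (Real.exp (-(m / 2) * l1 (s.1.2 - (N : ℤ) • s.2.1)) * Real.exp (-(m / 2) * l1 (s.2.2 - (N : ℤ) • s.2.1))) := by
    rintro ⟨⟨v, q⟩, ⟨u', w⟩⟩
    have hterm : ∀ e, |comp (dM K N S M κ u) K v q (Sum.inl a) e * dM K N S M κ' u' q w e (Sum.inl b)|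
        ≤ (CG * CV) * ((Real.exp (-(m / 4) * l1 (v - (N : ℤ) • u)) * Real.exp (-(m / 4) * l1 (q - (N : ℤ) • u))) *
          (Real.exp (-(m / 2) * l1 (q - (N : ℤ) • u')) * Real.exp (-(m / 2) * l1 (w - (N : ℤ) • u')))) := by
      intro e
      rw [abs_mul]
      have e1 := hGb v q (Sum.inl a) e
      have e2 := hV κ' u' q w e (Sum.inl b)
      rw [mul_add, Real.exp_add] at e1 e2
      calc |comp (dM K N S M κ u) K v q (Sum.inl a) e| * |dM K N S M κ' u' q w e (Sum.inl b)|
          ≤ (CG * (Real.exp (-(m / 4) * l1 (v - (N : ℤ) • u)) * Real.exp (-(m / 4) * l1 (q - (N : ℤ) • u)))) *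
            (CV * (Real.exp (-(m / 2) * l1 (q - (N : ℤ) • u')) * Real.exp (-(m / 2) * l1 (w - (N : ℤ) • u')))) :=
            mul_le_mul e1 e2 (abs_nonneg _) ((abs_nonneg _).trans e1)
        _ = _ := by ring
    calc |∑ e, comp (dM K N S M κ u) K v q (Sum.inl a) e * dM K N S M κ' u' q w e (Sum.inl b)|
        ≤ ∑ e, |comp (dM K N S M κ u) K v q (Sum.inl a) e * dM K N S M κ' u' q w e (Sum.inl b)| := Finset.abs_sum_le_sum_abs _ _
      _ ≤ ∑ _e : Fib d, (CG * CV) * ((Real.exp (-(m / 4) * l1 (v - (N : ℤ) • u)) * Real.exp (-(m / 4) * l1 (q - (N : ℤ) • u))) *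
          (Real.exp (-(m / 2) * l1 (q - (N : ℤ) • u')) * Real.exp (-(m / 2) * l1 (w - (N : ℤ) • u')))) :=
          Finset.sum_le_sum fun e _ => hterm e
      _ = _ := by simp only [Finset.sum_const, Finset.card_univ, nsmul_eq_mul, hA]; ring
  have hM0 : 0 ≤ fun s : (Site (d + 1) × Site (d + 1)) × (Site (d + 1) × Site (d + 1)) =>
      (A * Real.exp (-(m / 4) * l1 (s.1.1 - (N : ℤ) • u)) * Real.exp (-(m / 4) * l1 (s.1.2 - (N : ℤ) • u))) *
        (Real.exp (-(m / 2) * l1 (s.1.2 - (N : ℤ) • s.2.1)) * Real.exp (-(m / 2) * l1 (s.2.2 - (N : ℤ) • s.2.1))) :=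
    fun s => by positivity
  -- inner `(u′, w)` sums at fixed `(v, q)`
  have hIn0 : ∀ q : Site (d + 1), 0 ≤ fun uw : Site (d + 1) × Site (d + 1) =>
      Real.exp (-(m / 2) * l1 (q - (N : ℤ) • uw.1)) * Real.exp (-(m / 2) * l1 (uw.2 - (N : ℤ) • uw.1)) :=
    fun q uw => by positivity
  have hInfib : ∀ (q u' : Site (d + 1)), HasSum (fun w : Site (d + 1) =>
      Real.exp (-(m / 2) * l1 (q - (N : ℤ) • u')) * Real.exp (-(m / 2) * l1 (w - (N : ℤ) • u')))
      (Real.exp (-(m / 2) * l1 (q - (N : ℤ) • u')) * Zl (d + 1) (m / 2)) := by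
    intro q u'
    have hw : HasSum (fun w : Site (d + 1) => Real.exp (-(m / 2) * l1 (w - (N : ℤ) • u'))) (Zl (d + 1) (m / 2)) := by
      rw [← tsum_exp_shift' ((N : ℤ) • u')]
      exact (summable_exp_shift' hm2 _).hasSum
    exact hw.mul_left _
  have hInsum : ∀ q : Site (d + 1), Summable fun u' : Site (d + 1) => ∑' w : Site (d + 1),
      Real.exp (-(m / 2) * l1 (q - (N : ℤ) • u')) * Real.exp (-(m / 2) * l1 (w - (N : ℤ) • u')) := by
    intro q
    have e1 : (fun u' : Site (d + 1) => ∑' w : Site (d + 1),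
        Real.exp (-(m / 2) * l1 (q - (N : ℤ) • u')) * Real.exp (-(m / 2) * l1 (w - (N : ℤ) • u')))
        = fun u' => Real.exp (-(m / 2) * l1 (q - (N : ℤ) • u')) * Zl (d + 1) (m / 2) := funext fun u' => (hInfib q u').tsum_eq
    rw [e1]
    exact (summable_exp_coarse' (d := d) hN hm2 q).mul_right _
  have hIn : ∀ q : Site (d + 1), Summable fun uw : Site (d + 1) × Site (d + 1) =>
      Real.exp (-(m / 2) * l1 (q - (N : ℤ) • uw.1)) * Real.exp (-(m / 2) * l1 (uw.2 - (N : ℤ) • uw.1)) :=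
    fun q => (summable_prod_of_nonneg (hIn0 q)).2 ⟨fun u' => (hInfib q u').summable, hInsum q⟩
  have hInle : ∀ q : Site (d + 1), ∑' uw : Site (d + 1) × Site (d + 1),
      Real.exp (-(m / 2) * l1 (q - (N : ℤ) • uw.1)) * Real.exp (-(m / 2) * l1 (uw.2 - (N : ℤ) • uw.1)) ≤ U * Zl (d + 1) (m / 2) := by
    intro q
    rw [(hIn q).tsum_prod]
    have e1 : ∀ u' : Site (d + 1), ∑' w : Site (d + 1),
        Real.exp (-(m / 2) * l1 (q - (N : ℤ) • u')) * Real.exp (-(m / 2) * l1 (w - (N : ℤ) • u'))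
        = Real.exp (-(m / 2) * l1 (q - (N : ℤ) • u')) * Zl (d + 1) (m / 2) := fun u' => (hInfib q u').tsum_eq
    simp_rw [e1]
    rw [tsum_mul_right]
    exact mul_le_mul_of_nonneg_right (tsum_exp_coarse_le' (d := d) N hm2 q) (Zl_nonneg hm2)
  have hMfib : ∀ vq : Site (d + 1) × Site (d + 1), Summable fun uw : Site (d + 1) × Site (d + 1) =>
      (A * Real.exp (-(m / 4) * l1 (vq.1 - (N : ℤ) • u)) * Real.exp (-(m / 4) * l1 (vq.2 - (N : ℤ) • u))) *
        (Real.exp (-(m / 2) * l1 (vq.2 - (N : ℤ) • uw.1)) * Real.exp (-(m / 2) * l1 (uw.2 - (N : ℤ) • uw.1))) :=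
    fun vq => (hIn vq.2).mul_left _
  have hMb : ∀ vq : Site (d + 1) × Site (d + 1), ∑' uw : Site (d + 1) × Site (d + 1),
      (A * Real.exp (-(m / 4) * l1 (vq.1 - (N : ℤ) • u)) * Real.exp (-(m / 4) * l1 (vq.2 - (N : ℤ) • u))) *
        (Real.exp (-(m / 2) * l1 (vq.2 - (N : ℤ) • uw.1)) * Real.exp (-(m / 2) * l1 (uw.2 - (N : ℤ) • uw.1)))
      ≤ (A * (U * Zl (d + 1) (m / 2))) * (Real.exp (-(m / 4) * l1 (vq.1 - (N : ℤ) • u)) * Real.exp (-(m / 4) * l1 (vq.2 - (N : ℤ) • u))) := by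
    intro vq
    rw [tsum_mul_left]
    have h0 : 0 ≤ A * Real.exp (-(m / 4) * l1 (vq.1 - (N : ℤ) • u)) * Real.exp (-(m / 4) * l1 (vq.2 - (N : ℤ) • u)) := by positivity
    calc (A * Real.exp (-(m / 4) * l1 (vq.1 - (N : ℤ) • u)) * Real.exp (-(m / 4) * l1 (vq.2 - (N : ℤ) • u))) *
          ∑' uw : Site (d + 1) × Site (d + 1),
            Real.exp (-(m / 2) * l1 (vq.2 - (N : ℤ) • uw.1)) * Real.exp (-(m / 2) * l1 (uw.2 - (N : ℤ) • uw.1))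
        ≤ (A * Real.exp (-(m / 4) * l1 (vq.1 - (N : ℤ) • u)) * Real.exp (-(m / 4) * l1 (vq.2 - (N : ℤ) • u))) *
            (U * Zl (d + 1) (m / 2)) := mul_le_mul_of_nonneg_left (hInle vq.2) h0
      _ = _ := by ring
  have hMsum : Summable fun vq : Site (d + 1) × Site (d + 1) => ∑' uw : Site (d + 1) × Site (d + 1),
      (A * Real.exp (-(m / 4) * l1 (vq.1 - (N : ℤ) • u)) * Real.exp (-(m / 4) * l1 (vq.2 - (N : ℤ) • u))) *
        (Real.exp (-(m / 2) * l1 (vq.2 - (N : ℤ) • uw.1)) * Real.exp (-(m / 2) * l1 (uw.2 - (N : ℤ) • uw.1))) := by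
    refine Summable.of_nonneg_of_le (fun vq => tsum_nonneg fun uw => hM0 (vq, uw)) hMb ?_
    exact ((summable_exp_shift' hm4 _).mul_of_nonneg (summable_exp_shift' hm4 _) (fun _ => (Real.exp_pos _).le)
      (fun _ => (Real.exp_pos _).le)).mul_left _
  have hmaj := (summable_prod_of_nonneg hM0).2 ⟨hMfib, hMsum⟩
  have hΓ : Summable fun s : (Site (d + 1) × Site (d + 1)) × (Site (d + 1) × Site (d + 1)) =>
      ∑ e, comp (dM K N S M κ u) K s.1.1 s.1.2 (Sum.inl a) e * dM K N S M κ' s.2.1 s.1.2 s.2.2 e (Sum.inl b) :=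
    Summable.of_norm_bounded hmaj (fun s => by rw [Real.norm_eq_abs]; exact hGle s)
  -- the `(u′, w)`-fibres at fixed `(v, q)`
  have hfib : ∀ vq : Site (d + 1) × Site (d + 1), HasSum (fun uw : Site (d + 1) × Site (d + 1) =>
      ∑ e, comp (dM K N S M κ u) K vq.1 vq.2 (Sum.inl a) e * dM K N S M κ' uw.1 vq.2 uw.2 e (Sum.inl b))
      (∑ e, comp (dM K N S M κ u) K vq.1 vq.2 (Sum.inl a) e *
        ∑' w : Site (d + 1), ∑ κ'' : Fin (d + 1), ρR κ' (Sum.inl κ'') * ∑' t : Site (d + 1), S κ'' t vq.2 w e (Sum.inl b)) :=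
    fun vq => hasSum_sum fun e _ => (hasSum_bond_leg2_dM hK hm hcol hK0 hS hM κ' vq.2 e (Sum.inl b)).mul_left _
  have hswap := hasSum_fibre_swap hΓ hfib
  -- the value of the `(v, q)`-series: the q-vectors of the table-summed stencil, collapsed, meet `dM_b` on two constant legs
  have hVal_inl : ∀ (q : Site (d + 1)) (γ : Fin (d + 1)), (∑' w : Site (d + 1), ∑ κ'' : Fin (d + 1),
      ρR κ' (Sum.inl κ'') * ∑' t : Site (d + 1), S κ'' t q w (Sum.inl γ) (Sum.inl b)) = 0 := by
    intro q γ
    rw [Summable.tsum_finsetSum (fun κ'' _ => (summable_tableSum_leg2 hS hm κ'' q (Sum.inl γ) (Sum.inl b)).mul_left _)]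
    refine Finset.sum_eq_zero fun κ'' _ => ?_
    rw [tsum_mul_left, (hasSum_tableSum_leg2 (hS2 κ'' q γ b)).tsum_eq, mul_zero]
  have hΨ : ∀ (κ'' ρ'' : Fin (d + 1)) (q s : Site (d + 1)),
      (∑' w : Site (d + 1), ∑' t : Site (d + 1), S κ'' t (q + (N : ℤ) • s) w (Sum.inr ρ'') (Sum.inl b))
        = ∑' w : Site (d + 1), ∑' t : Site (d + 1), S κ'' t q w (Sum.inr ρ'') (Sum.inl b) := by
    intro κ'' ρ'' q s
    rw [← (Equiv.addRight ((N : ℤ) • s)).tsum_eq (fun w => ∑' t : Site (d + 1), S κ'' t (q + (N : ℤ) • s) w (Sum.inr ρ'') (Sum.inl b))]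
    refine tsum_congr fun w => ?_
    simp only [Equiv.coe_addRight]
    exact tableSum_periodic hSt κ'' q w (Sum.inr ρ'') (Sum.inl b) s
  have hVal_inr : ∀ (q : Site (d + 1)) (ρ'' : Fin (d + 1)), (∑' w : Site (d + 1), ∑ κ'' : Fin (d + 1),
      ρR κ' (Sum.inl κ'') * ∑' t : Site (d + 1), S κ'' t q w (Sum.inr ρ'') (Sum.inl b))
        = ∑ κ'' : Fin (d + 1), ρR κ' (Sum.inl κ'') * ∑' w : Site (d + 1), ∑' t : Site (d + 1), S κ'' t q w (Sum.inr ρ'') (Sum.inl b) := by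
    intro q ρ''
    rw [Summable.tsum_finsetSum (fun κ'' _ => (summable_tableSum_leg2 hS hm κ'' q (Sum.inr ρ'') (Sum.inl b)).mul_left _)]
    exact Finset.sum_congr rfl fun κ'' _ => tsum_mul_left
  -- slices of `dM_b` and the coarse column sums of `dM_b ∘ K` (right half read-out)
  have hslice : ∀ (v : Site (d + 1)) (g : Fib d), Summable fun y : Site (d + 1) => dM K N S M κ u v y (Sum.inl a) g :=
    fun v g => (summable_prod_of_biLoc (hV κ u) hm2 (Sum.inl a) g).prod_factor v
  have hcolp : ∀ (v : Site (d + 1)) (ρ'' : Fin (d + 1)), HasSum (fun q' : Site (d + 1) =>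
      comp (dM K N S M κ u) K v ((N : ℤ) • q') (Sum.inl a) (Sum.inr ρ''))
      (∑' y : Site (d + 1), ∑ g, dM K N S M κ u v y (Sum.inl a) g * ρR ρ'' g) :=
    fun v ρ'' => hasSum_halfReadout_right hK hm ρ'' (hcol ρ'') v (Sum.inl a) (hslice v)
  have hoffG : ∀ (v q : Site (d + 1)) (ρ'' : Fin (d + 1)), Torus.proj N q ≠ 0 →
      comp (dM K N S M κ u) K v q (Sum.inl a) (Sum.inr ρ'') = 0 := by
    intro v q ρ'' hq
    simp only [comp, hoffR _ q _ ρ'' hq, mul_zero, Finset.sum_const_zero, tsum_zero]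
  have hφ : ∀ (v : Site (d + 1)) (ρ'' κ'' : Fin (d + 1)), HasSum (fun q : Site (d + 1) =>
      comp (dM K N S M κ u) K v q (Sum.inl a) (Sum.inr ρ'') *
        ∑' w : Site (d + 1), ∑' t : Site (d + 1), S κ'' t q w (Sum.inr ρ'') (Sum.inl b))
      ((∑' y : Site (d + 1), ∑ g, dM K N S M κ u v y (Sum.inl a) g * ρR ρ'' g) *
        ∑' w : Site (d + 1), ∑' t : Site (d + 1), S κ'' t 0 w (Sum.inr ρ'') (Sum.inl b)) :=
    fun v ρ'' κ'' => hasSum_collapse_right_pt (hcolp v ρ'') (hoffG v · ρ'') (hΨ κ'' ρ'')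
  -- the row value `r_v(ρ″)` is a finite combination of `dM_b` on two constant kernel legs
  have hr : ∀ (v : Site (d + 1)) (ρ'' : Fin (d + 1)), (∑' y : Site (d + 1), ∑ g, dM K N S M κ u v y (Sum.inl a) g * ρR ρ'' g)
      = ∑ γ : Fin (d + 1), ρR ρ'' (Sum.inl γ) * ∑' y : Site (d + 1), dM K N S M κ u v y (Sum.inl a) (Sum.inl γ) := by
    intro v ρ''
    rw [Summable.tsum_finsetSum (fun g _ => (hslice v g).mul_right _), Fintype.sum_sum_type]
    have h0 : ∑ μ : Fin (d + 1), ∑' y : Site (d + 1), dM K N S M κ u v y (Sum.inl a) (Sum.inr μ) * ρR ρ'' (Sum.inr μ) = 0 :=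
      Finset.sum_eq_zero fun μ _ => by simp only [hR0, mul_zero, tsum_zero]
    rw [h0, add_zero]
    exact Finset.sum_congr rfl fun γ _ => by rw [tsum_mul_right, mul_comm]
  have hlegs : ∀ γ : Fin (d + 1), HasSum (fun v : Site (d + 1) => ∑' y : Site (d + 1), dM K N S M κ u v y (Sum.inl a) (Sum.inl γ)) 0 := by
    intro γ
    have h := hasSum_dM_legs_ff hK hm hK0' hS hS0 hM hMt κ u a γ
    exact h.prod_fiberwise fun v => (h.summable.prod_factor v).hasSum
  -- the `(v, q)`-series of the fibre values is zero
  have hgs : Summable fun vq : Site (d + 1) × Site (d + 1) => ∑ e, comp (dM K N S M κ u) K vq.1 vq.2 (Sum.inl a) e *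
      ∑' w : Site (d + 1), ∑ κ'' : Fin (d + 1), ρR κ' (Sum.inl κ'') * ∑' t : Site (d + 1), S κ'' t vq.2 w e (Sum.inl b) :=
    hΓ.prod.congr fun vq => (hfib vq).tsum_eq
  have hinner : ∀ v : Site (d + 1), HasSum (fun q : Site (d + 1) => ∑ e, comp (dM K N S M κ u) K v q (Sum.inl a) e *
      ∑' w : Site (d + 1), ∑ κ'' : Fin (d + 1), ρR κ' (Sum.inl κ'') * ∑' t : Site (d + 1), S κ'' t q w e (Sum.inl b))
      (∑ ρ'' : Fin (d + 1), ∑ κ'' : Fin (d + 1), ρR κ' (Sum.inl κ'') *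
        ((∑ γ : Fin (d + 1), ρR ρ'' (Sum.inl γ) * ∑' y : Site (d + 1), dM K N S M κ u v y (Sum.inl a) (Sum.inl γ)) *
          ∑' w : Site (d + 1), ∑' t : Site (d + 1), S κ'' t 0 w (Sum.inr ρ'') (Sum.inl b))) := by
    intro v
    have h := hasSum_sum (s := (Finset.univ : Finset (Fin (d + 1)))) fun ρ'' _ =>
      hasSum_sum (s := (Finset.univ : Finset (Fin (d + 1)))) fun κ'' _ => ((hφ v ρ'' κ'').mul_left (ρR κ' (Sum.inl κ'')))
    simp_rw [hr] at h
    refine h.congr_fun fun q => ?_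
    rw [Fintype.sum_sum_type]
    simp_rw [hVal_inl, mul_zero, Finset.sum_const_zero, zero_add, hVal_inr, Finset.mul_sum]
    exact Finset.sum_congr rfl fun ρ'' _ => Finset.sum_congr rfl fun κ'' _ => by ring
  have htot : (∑' vq : Site (d + 1) × Site (d + 1), ∑ e, comp (dM K N S M κ u) K vq.1 vq.2 (Sum.inl a) e *
      ∑' w : Site (d + 1), ∑ κ'' : Fin (d + 1), ρR κ' (Sum.inl κ'') * ∑' t : Site (d + 1), S κ'' t vq.2 w e (Sum.inl b)) = 0 := by
    rw [hgs.tsum_prod]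
    simp_rw [(hinner _).tsum_eq]
    have hs : ∀ (ρ'' κ'' : Fin (d + 1)), Summable fun v : Site (d + 1) => ρR κ' (Sum.inl κ'') *
        ((∑ γ : Fin (d + 1), ρR ρ'' (Sum.inl γ) * ∑' y : Site (d + 1), dM K N S M κ u v y (Sum.inl a) (Sum.inl γ)) *
          ∑' w : Site (d + 1), ∑' t : Site (d + 1), S κ'' t 0 w (Sum.inr ρ'') (Sum.inl b)) :=
      fun ρ'' κ'' => ((summable_sum fun γ _ => (hlegs γ).summable.mul_left _).mul_right _).mul_left _
    rw [Summable.tsum_finsetSum (fun ρ'' _ => summable_sum fun κ'' _ => hs ρ'' κ'')]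
    refine Finset.sum_eq_zero fun ρ'' _ => ?_
    rw [Summable.tsum_finsetSum (fun κ'' _ => hs ρ'' κ'')]
    refine Finset.sum_eq_zero fun κ'' _ => ?_
    rw [tsum_mul_left, tsum_mul_right, Summable.tsum_finsetSum (fun γ _ => (hlegs γ).summable.mul_left _)]
    have h0 : ∑ γ : Fin (d + 1), ∑' v : Site (d + 1), ρR ρ'' (Sum.inl γ) *
        ∑' y : Site (d + 1), dM K N S M κ u v y (Sum.inl a) (Sum.inl γ) = 0 :=
      Finset.sum_eq_zero fun γ _ => by rw [tsum_mul_left, (hlegs γ).tsum_eq, mul_zero]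
    rw [h0, zero_mul, mul_zero]
  rw [htot] at hswap
  -- from the `(u′, w)` pair series to the bond series of the double-leg sums
  have hone := hswap.prod_fiberwise fun u' => (hswap.summable.prod_factor u').hasSum
  refine hone.congr_fun fun u' => ?_
  -- regroup the triple family at fixed `u′`
  have h3 : Summable fun p : (Site (d + 1) × Site (d + 1)) × Site (d + 1) =>
      ∑ e, comp (dM K N S M κ u) K p.1.1 p.1.2 (Sum.inl a) e * dM K N S M κ' u' p.1.2 p.2 e (Sum.inl b) :=
    hΓ.comp_injective (i := fun p : (Site (d + 1) × Site (d + 1)) × Site (d + 1) => (p.1, (u', p.2)))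
      (fun p p' h => by
        simp only [Prod.mk.injEq] at h
        exact Prod.ext h.1 h.2.2)
  set ε : (Site (d + 1) × Site (d + 1)) × Site (d + 1) ≃ (Site (d + 1) × Site (d + 1)) × Site (d + 1) :=
    ⟨fun p => ((p.1.1, p.2), p.1.2), fun p => ((p.1.1, p.2), p.1.2), fun _ => rfl, fun _ => rfl⟩ with hε
  have h3' : Summable fun p : (Site (d + 1) × Site (d + 1)) × Site (d + 1) =>
      ∑ e, comp (dM K N S M κ u) K p.1.1 p.2 (Sum.inl a) e * dM K N S M κ' u' p.2 p.1.2 e (Sum.inl b) :=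
    (ε.summable_iff.2 h3).congr fun p => rfl
  have eL : (∑' vw : Site (d + 1) × Site (d + 1), comp (comp (dM K N S M κ u) K) (dM K N S M κ' u') vw.1 vw.2 (Sum.inl a) (Sum.inl b))
      = ∑' p : (Site (d + 1) × Site (d + 1)) × Site (d + 1),
          ∑ e, comp (dM K N S M κ u) K p.1.1 p.2 (Sum.inl a) e * dM K N S M κ' u' p.2 p.1.2 e (Sum.inl b) := by
    rw [h3'.tsum_prod]
    simp only [comp]
  have eε : (∑' p : (Site (d + 1) × Site (d + 1)) × Site (d + 1),
      ∑ e, comp (dM K N S M κ u) K p.1.1 p.2 (Sum.inl a) e * dM K N S M κ' u' p.2 p.1.2 e (Sum.inl b))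
      = ∑' p : (Site (d + 1) × Site (d + 1)) × Site (d + 1),
          ∑ e, comp (dM K N S M κ u) K p.1.1 p.1.2 (Sum.inl a) e * dM K N S M κ' u' p.1.2 p.2 e (Sum.inl b) :=
    ε.tsum_eq (fun p : (Site (d + 1) × Site (d + 1)) × Site (d + 1) =>
      ∑ e, comp (dM K N S M κ u) K p.1.1 p.1.2 (Sum.inl a) e * dM K N S M κ' u' p.1.2 p.2 e (Sum.inl b))
  have eR : (∑' p : (Site (d + 1) × Site (d + 1)) × Site (d + 1),
      ∑ e, comp (dM K N S M κ u) K p.1.1 p.1.2 (Sum.inl a) e * dM K N S M κ' u' p.1.2 p.2 e (Sum.inl b))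
      = ∑' w : Site (d + 1), ∑' vq : Site (d + 1) × Site (d + 1),
          ∑ e, comp (dM K N S M κ u) K vq.1 vq.2 (Sum.inl a) e * dM K N S M κ' u' vq.2 w e (Sum.inl b) := by
    have e3 : (∑' p' : Site (d + 1) × (Site (d + 1) × Site (d + 1)),
        ∑ e, comp (dM K N S M κ u) K p'.swap.1.1 p'.swap.1.2 (Sum.inl a) e * dM K N S M κ' u' p'.swap.1.2 p'.swap.2 e (Sum.inl b))
        = ∑' p : (Site (d + 1) × Site (d + 1)) × Site (d + 1),
            ∑ e, comp (dM K N S M κ u) K p.1.1 p.1.2 (Sum.inl a) e * dM K N S M κ' u' p.1.2 p.2 e (Sum.inl b) := by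
      have h1 := (Equiv.prodComm (Site (d + 1)) (Site (d + 1) × Site (d + 1))).tsum_eq
        (fun p : (Site (d + 1) × Site (d + 1)) × Site (d + 1) =>
          ∑ e, comp (dM K N S M κ u) K p.1.1 p.1.2 (Sum.inl a) e * dM K N S M κ' u' p.1.2 p.2 e (Sum.inl b))
      simpa only [Equiv.prodComm_apply] using h1
    rw [← e3, h3.prod_symm.tsum_prod]
    rfl
  rw [eL, eε, eR]

end Summit.QuantumFields.BalabanUV.Beta.GAN24.ExchangeBondLegs

end
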